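import Summits.CriticalPhenomena.PercolationContinuityZ3.Theorems.SahiMasterFamilyGluedCross

/-!
# The MULTI-CROSS lemma for the glued frame field: annihilator points of distinct non-pure members share two failed pure members

Unit `prim-master-conj` (crux anchor stmt-CriticalPhenomena-4575), gen 12; memo HOME/prim-master-conj/TIGHTNESS-IV.md §5.
Setting `GluedSetting` with a core-free coordinate.  For a finite set `Z` of members and configurations `χ z ∈ gann z` (`z ∈ Z`; such members are
non-pure):

  **`GluedSetting.two_le_card_multiCross`**: at least two PURE members fail at every `χ z`, `z ∈ Z` (for `Z` non-empty).

`|Z| = 1` is (α) (`two_le_card_pureFail_gann`), `|Z| = 2` the cross lemma.  Ingredients: `nested_robust` — in a structured family, the nested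
fail-set sub-families of successive annihilator points are structured with the restricted canonical frames (C + SYM + T1 + FR, iterated); the
owner argument in a deletion face (`exists_owner_multi`, `mem_biUnion_of_multi`: every core-free coordinate lies in some `χ z`); and a strong
induction on `∑ |χ z|` (removing a coordinate without letting a new pure member fail everywhere gives a smaller violating tuple), closed by the
vertex lemma on the glued frames of the `z ∈ Z` and on the pure members.  This is the last input of the all-orders chain construction
(`SahiMasterFamilyAllOrders`).  Pure combinatorics; axioms standard. [this work]
-/

noncomputable section

open scoped Classical

namespace Summit.CriticalPhenomena.PercolationContinuityZ3.Theorems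

namespace GluedFrames

open Finset Function
open Literature.Probability.LatticeModels.Kahn2022 (Affects)

variable {ι : Type*} [Fintype ι] {κ : Type*}

/-! ### Nested robustness in a structured family -/

/-- **Nested fail-set sub-families are structured with the restricted frames.**  In a structured family `Φ` on `W₀`, peel the members of the list
`zs` one by one, each time passing to a sub-family containing `S`, the later members of `zs`, and the members failing at the annihilator point
`χ z` of the peeled member `z`: the final sub-family `R ⊇ S` is structured, its canonical frames are those of `W₀`, and every member of `R`
outside `S` is outside `zs` and fails at every `χ z`, `z ∈ zs`. [this work] -/
theorem nested_robust (Φ : κ → Set (Set ι)) (hΦ : ∀ k, IsUpperSet (Φ k)) (hΦne : ∀ k, (Φ k).Nonempty) (χ : κ → Set ι) :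
    ∀ (zs : List κ) (W₀ S : Finset κ), Structured Φ W₀ → zs.Nodup → S ⊆ W₀ →
      (∀ z ∈ zs, z ∈ W₀ ∧ z ∉ S ∧ χ z ∈ cframe Φ W₀ z ∧ χ z ∉ Φ z) →
      ∃ R : Finset κ, S ⊆ R ∧ R ⊆ W₀ ∧ Structured Φ R ∧ (∀ w ∈ R, cframe Φ R w = cframe Φ W₀ w) ∧
        (∀ w ∈ R, w ∉ S → w ∉ zs ∧ ∀ z ∈ zs, χ z ∉ Φ w)
  | [], W₀, S, hW, _, hS, _ => ⟨W₀, hS, subset_rfl, hW, fun _ _ => rfl, fun w _ _ => ⟨List.not_mem_nil, fun z hz => absurd hz List.not_mem_nil⟩⟩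
  | z :: zs, W₀, S, hW, hnd, hS, hzs => by
    obtain ⟨hzW, hzS, hzA, hzU⟩ := hzs z List.mem_cons_self
    have hzzs : z ∉ zs := (List.nodup_cons.1 hnd).1
    have hN : ¬ (cframe Φ W₀ z ⊆ Φ z) := fun h => hzU (h hzA)
    have hWz : Structured Φ (W₀.erase z) := structured_erase_of_not_subset Φ hΦ hΦne hW hzW hN
    have hsafe := annihilator_subset_safe_erase Φ hΦ hΦne hW hzW hWz ⟨hzA, hzU⟩
    obtain ⟨-, hrob⟩ := (mem_safe Φ).1 hsafe
    set F := failSet Φ (W₀.erase z) (χ z) with hFdef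
    set R₁ := F ∪ (S ∪ zs.toFinset) with hR₁def
    have hR₁W : R₁ ⊆ W₀.erase z := by
      intro x hx
      rcases mem_union.1 hx with hx | hx
      · exact failSet_subset Φ _ _ hx
      · rcases mem_union.1 hx with hx | hx
        · exact mem_erase.2 ⟨fun e => hzS (e ▸ hx), hS hx⟩
        · have hx' := List.mem_toFinset.1 hx
          exact mem_erase.2 ⟨fun e => hzzs (e ▸ hx'), (hzs x (List.mem_cons_of_mem z hx')).1⟩
    have hFR₁ : F ⊆ R₁ := subset_union_left
    have hR₁ : Structured Φ R₁ := hrob R₁ hFR₁ hR₁W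
    have hfr₁ : ∀ w ∈ R₁, cframe Φ R₁ w = cframe Φ W₀ w := by
      intro w hw
      rw [cframe_eq_of_robust Φ hΦ hΦne ((W₀.erase z) \ R₁).card le_rfl hWz hR₁W
        (fun R' h1 h2 => hrob R' (hFR₁.trans h1) h2) w hw]
      exact cframe_erase Φ hΦ hΦne hW hWz (hR₁W hw)
    have hSR₁ : S ⊆ R₁ := fun x hx => mem_union_right _ (mem_union_left _ hx)
    obtain ⟨R, hSR, hRR₁, hR, hfr, hout⟩ := nested_robust Φ hΦ hΦne χ zs R₁ S hR₁ (List.nodup_cons.1 hnd).2 hSR₁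
      (fun z' hz' => by
        obtain ⟨hz'W, hz'S, hz'A, hz'U⟩ := hzs z' (List.mem_cons_of_mem z hz')
        have hz'R₁ : z' ∈ R₁ := mem_union_right _ (mem_union_right _ (List.mem_toFinset.2 hz'))
        exact ⟨hz'R₁, hz'S, by rw [hfr₁ z' hz'R₁]; exact hz'A, hz'U⟩)
    refine ⟨R, hSR, hRR₁.trans (hR₁W.trans (erase_subset _ _)), hR, fun w hw => (hfr w hw).trans (hfr₁ w (hRR₁ hw)),
      fun w hw hwS => ?_⟩
    obtain ⟨hwzs, hwχ⟩ := hout w hw hwS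
    have hwR₁ := hRR₁ hw
    have hwF : w ∈ F := by
      rcases mem_union.1 hwR₁ with h | h
      · exact h
      · rcases mem_union.1 h with h | h
        · exact absurd h hwS
        · exact absurd (List.mem_toFinset.1 h) hwzs
    have hwz : w ≠ z := ne_of_mem_erase (hR₁W hwR₁)
    refine ⟨fun h => ?_, fun z' hz' => ?_⟩
    · rcases List.mem_cons.1 h with h | h
      · exact hwz h
      · exact hwzs h
    · rcases List.mem_cons.1 hz' with h | h
      · subst h; exact ((mem_failSet Φ).1 hwF).2
      · exact hwχ z' h

namespace GluedSetting

variable {U : κ → Set (Set ι)} {W : Finset κ} (G : GluedSetting U W)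
include G

/-! ### Owners, for a tuple of annihilator points -/

/-- **Owner lemma, tuple form.**  `Z` a non-empty set of members with annihilator points `χ z ∈ gann z`; at most one pure member fails at all of
them; a core-free `f` outside every `χ z`.  Then some globally non-pure member outside `Z` is pure in the deletion face at `f`. [this work] -/
theorem exists_owner_multi {Z : Finset κ} {χ : κ → Set ι} (hZ : Z.Nonempty) (hχ : ∀ z ∈ Z, χ z ∈ gann U W z)
    (hA : ((W.filter fun p => gann U W p = ∅).filter fun p => ∀ z ∈ Z, χ z ∉ U p).card ≤ 1)
    {f : ι} (hf : CoreFree U f) (hfχ : ∀ z ∈ Z, f ∉ χ z) :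
    ∃ c ∈ W, c ∉ Z ∧ (gann U W c).Nonempty ∧ cframe (faceF U f) W c ⊆ faceF U f c := by
  obtain ⟨hFs, hFc⟩ := G.hF f hf
  set Φ := faceF U f with hΦdef
  have hΦU : ∀ k, IsUpperSet (Φ k) := isUpperSet_faceF U G.hU f
  have hΦne : ∀ k, (Φ k).Nonempty := faceF_nonempty U hf
  have hmemA : ∀ {x : κ} {ω : Set ι}, f ∉ ω → (ω ∈ cframe Φ W x ↔ ω ∈ gframe U W x) := by
    intro x ω hfω; rw [hFc x (G.hWU x), mem_secAt_false_iff_of_notMem hfω]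
  have hmemU : ∀ {x : κ} {ω : Set ι}, f ∉ ω → (ω ∈ Φ x ↔ ω ∈ U x) := by
    intro x ω hfω; rw [hΦdef, faceF_apply, mem_secAt_false_iff_of_notMem hfω]
  -- peel all members of `Z` but one
  obtain ⟨z₀, hz₀⟩ := hZ
  set zs := (Z.erase z₀).toList with hzsdef
  have hzsmem : ∀ z, z ∈ zs ↔ z ≠ z₀ ∧ z ∈ Z := fun z => by rw [hzsdef, mem_toList, mem_erase]
  obtain ⟨R, hSR, -, hR, hfr, hout⟩ := nested_robust Φ hΦU hΦne χ zs W {z₀} hFs (nodup_toList _)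
    (by intro x hx; rw [mem_singleton] at hx; subst hx; exact G.hWU _)
    (fun z hz => by
      obtain ⟨hzz₀, hzZ⟩ := (hzsmem z).1 hz
      exact ⟨G.hWU z, by rwa [mem_singleton], (hmemA (hfχ z hzZ)).2 (hχ z hzZ).1,
        fun h => (hχ z hzZ).2 ((hmemU (hfχ z hzZ)).1 h)⟩)
  have hz₀R : z₀ ∈ R := hSR (mem_singleton_self _)
  have hA₀ : χ z₀ ∈ cframe Φ R z₀ := by rw [hfr z₀ hz₀R]; exact (hmemA (hfχ z₀ hz₀)).2 (hχ z₀ hz₀).1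
  have hU₀ : χ z₀ ∉ Φ z₀ := fun h => (hχ z₀ hz₀).2 ((hmemU (hfχ z₀ hz₀)).1 h)
  obtain ⟨a, ha, b, hb, hab, haz, hbz, hfa, hfb, hθa, hθb⟩ := exists_two_pure_not_mem Φ hΦU hΦne hR hz₀R hA₀ hU₀
  -- `a, b ∉ Z` fail at every `χ z`
  have hfail : ∀ {x}, x ∈ R → x ≠ z₀ → x ∉ Z ∧ ∀ z ∈ Z, z ≠ z₀ → χ z ∉ U x := by
    intro x hx hxz
    obtain ⟨hxzs, hxχ⟩ := hout x hx (by rwa [mem_singleton])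
    exact ⟨fun hxZ => hxzs ((hzsmem x).2 ⟨hxz, hxZ⟩),
      fun z hz hzz h => hxχ z ((hzsmem z).2 ⟨hzz, hz⟩) ((hmemU (hfχ z hz)).2 h)⟩
  have hχa : ∀ z ∈ Z, χ z ∉ U a := by
    intro z hz
    by_cases hzz : z = z₀
    · subst hzz; exact fun h => hθa ((hmemU (hfχ _ hz)).2 h)
    · exact (hfail ha haz).2 z hz hzz
  have hχb : ∀ z ∈ Z, χ z ∉ U b := by
    intro z hz
    by_cases hzz : z = z₀
    · subst hzz; exact fun h => hθb ((hmemU (hfχ _ hz)).2 h)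
    · exact (hfail hb hbz).2 z hz hzz
  have hnot : ¬ (gann U W a = ∅ ∧ gann U W b = ∅) := by
    rintro ⟨hpa, hpb⟩
    have hsub : ({a, b} : Finset κ) ⊆ ((W.filter fun p => gann U W p = ∅).filter fun p => ∀ z ∈ Z, χ z ∉ U p) := by
      intro c hc
      simp only [mem_filter]
      rcases mem_insert.1 hc with rfl | hc
      · exact ⟨⟨G.hWU _, hpa⟩, hχa⟩
      · rw [mem_singleton] at hc; subst hc; exact ⟨⟨G.hWU _, hpb⟩, hχb⟩
    have := (card_le_card hsub).trans hA
    rw [card_pair hab] at this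
    omega
  by_cases hpa : gann U W a = ∅
  · refine ⟨b, G.hWU b, (hfail hb hbz).1, Set.nonempty_iff_ne_empty.2 fun h => hnot ⟨hpa, h⟩, ?_⟩
    rw [← hfr b hb]; exact hfb.le
  · refine ⟨a, G.hWU a, (hfail ha haz).1, Set.nonempty_iff_ne_empty.2 hpa, ?_⟩
    rw [← hfr a ha]; exact hfa.le

/-- **KEY, tuple form**: if each `χ z` lies inside the glued block of `z` plus the pure supports and at most one pure member fails at all of them,
then every core-free coordinate lies in some `χ z`. [this work] -/
theorem mem_biUnion_of_multi {Z : Finset κ} {χ : κ → Set ι} (hZ : Z.Nonempty) (hχ : ∀ z ∈ Z, χ z ∈ gann U W z)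
    (hT : ∀ z ∈ Z, χ z ⊆ ↑(esupp (gframe U W z)) ∪ ⋃ q ∈ W.filter (fun p => gann U W p = ∅), (↑(esupp (U q)) : Set ι))
    (hA : ((W.filter fun p => gann U W p = ∅).filter fun p => ∀ z ∈ Z, χ z ∉ U p).card ≤ 1)
    {f : ι} (hf : CoreFree U f) : ∃ z ∈ Z, f ∈ χ z := by
  by_contra hnot
  push Not at hnot
  obtain ⟨c, hc, hcZ, hcN, hcpure⟩ := G.exists_owner_multi hZ hχ hA hf hnot
  have hfc : f ∈ esupp (gframe U W c) := mem_esupp_of_pure_in_faceF U W G.hU (G.hF f hf).2 hc hcpure hcN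
  have key : ∀ z ∈ Z, ∀ g ∈ esupp (gframe U W c), g ∉ χ z := by
    intro z hz g hg hgχ
    have hcz : c ≠ z := fun e => hcZ (e ▸ hz)
    rcases hT z hz hgχ with h | h
    · exact Finset.disjoint_left.1 (G.hd c hc z (G.hWU z) hcz) hg (mem_coe.1 h)
    · rw [Set.mem_iUnion₂] at h
      obtain ⟨q, hq, hgq⟩ := h
      rw [mem_filter] at hq
      exact G.not_mem_esupp_gframe_of_pure hq.1 hq.2 hcN (mem_coe.1 hgq) hg
  have hV : ∀ ψ ∈ gann U W c, ↑(verts (gframe U W c)) ⊆ ψ := by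
    intro ψ hψ g hg
    obtain ⟨hgcf, hgc⟩ := G.mem_verts_gframe_iff.1 (mem_coe.1 hg)
    obtain ⟨c', hc', -, hc'N, hc'pure⟩ := G.exists_owner_multi hZ hχ hA hgcf (fun z hz => key z hz g hgc)
    have hgc' : g ∈ esupp (gframe U W c') := mem_esupp_of_pure_in_faceF U W G.hU (G.hF g hgcf).2 hc' hc'pure hc'N
    have hcc' : c' = c := by
      by_contra hne'
      exact Finset.disjoint_left.1 (G.hd c' hc' c hc hne') hgc' hgc
    subst hcc'
    exact forall_mem_of_pure_in_faceF U W (G.hF g hgcf).2 hc' hc'pure hψ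
  have hempty := verts_eq_empty_of_downClosed (isUpperSet_gframe U W G.hU c) (fun ψ hψ => hψ.1) hcN
    (fun ψ hψ ψ' hle hψ' => mem_gann_of_subset U W G.hU hψ hle hψ') hV
  have : f ∈ verts (gframe U W c) := mem_verts_gframe_of_coreFree U W G.hU hf hfc
  rw [hempty] at this
  exact notMem_empty f this

/-! ### The multi-cross lemma -/

/-- **The inductive step of the multi-cross lemma.**  A violating tuple (at most one pure member failing at every `χ z`) from which no single
coordinate can be removed without letting a new pure member fail everywhere (the induction hypotheses) does not exist. [this work] -/
theorem multiCross_step (hE0 : ∃ f, CoreFree U f) {Z : Finset κ} {χ : κ → Set ι} (hZ : Z.Nonempty)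
    (hχ : ∀ z ∈ Z, χ z ∈ gann U W z)
    (hA : ((W.filter fun p => gann U W p = ∅).filter fun p => ∀ z ∈ Z, χ z ∉ U p).card ≤ 1)
    (IH : ∀ z ∈ Z, ∀ g ∈ χ z, χ z \ {g} ∈ gann U W z →
      (∀ q ∈ W, gann U W q = ∅ → χ z \ {g} ∉ U q → (∀ z' ∈ Z, z' ≠ z → χ z' ∉ U q) → χ z ∉ U q) → False) : False := by
  have hU := G.hU
  have hzN : ∀ z ∈ Z, (gann U W z).Nonempty := fun z hz => ⟨_, hχ z hz⟩
  set SP : Set ι := ⋃ q ∈ W.filter (fun p => gann U W p = ∅), (↑(esupp (U q)) : Set ι) with hSPdef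
  -- (r1) each configuration lies inside its member's glued block plus the pure supports
  have hT : ∀ z ∈ Z, χ z ⊆ ↑(esupp (gframe U W z)) ∪ SP := by
    intro z hz g hg
    by_contra hgT
    rw [Set.mem_union, not_or] at hgT
    refine IH z hz g hg ⟨diff_singleton_mem_of_not_affects (isUpperSet_gframe U W hU z)
      (fun ha => hgT.1 (mem_coe.2 (mem_esupp.2 ha))) (hχ z hz).1, fun h => (hχ z hz).2 (hU z Set.sdiff_subset h)⟩
      fun q hq hpq hn _ => ?_
    have hgq : ¬ Affects (U q) g := fun ha =>
      hgT.2 (Set.mem_biUnion (mem_filter.2 ⟨hq, hpq⟩) (mem_coe.2 (mem_esupp.2 ha)))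
    exact fun h => hn ((diff_singleton_mem_iff_of_not_affects (hU q) hgq hg).2 h)
  have KEY : ∀ f, CoreFree U f → ∃ z ∈ Z, f ∈ χ z := fun f hf => G.mem_biUnion_of_multi hZ hχ hT hA hf
  -- a coordinate of the block of `z ∈ Z` outside `χ z` is in no `χ z'`
  have huniq : ∀ z ∈ Z, ∀ f ∈ esupp (gframe U W z), ∀ z' ∈ Z, f ∈ χ z' → z' = z := by
    intro z hz f hfz z' hz' hfz'
    by_contra hne
    rcases hT z' hz' hfz' with h | h
    · exact Finset.disjoint_left.1 (G.hd z (G.hWU z) z' (G.hWU z') (Ne.symm hne)) hfz (mem_coe.1 h)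
    · rw [Set.mem_iUnion₂] at h
      obtain ⟨q, hq, hfq⟩ := h
      rw [mem_filter] at hq
      exact G.not_mem_esupp_gframe_of_pure hq.1 hq.2 (hzN z hz) (mem_coe.1 hfq) hfz
  -- (i) the glued frames of the members of `Z` have no vertex
  have hVz : ∀ z ∈ Z, verts (gframe U W z) = ∅ := by
    intro z hz
    have hin : ∀ f ∈ verts (gframe U W z), f ∈ χ z := by
      intro f hf
      obtain ⟨hfcf, hfz⟩ := G.mem_verts_gframe_iff.1 hf
      obtain ⟨z', hz', hfz'⟩ := KEY f hfcf
      rwa [huniq z hz f hfz z' hz' hfz'] at hfz'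
    refine verts_eq_empty_of_pivotal (isUpperSet_gframe U W hU z) (hχ z hz).1 (fun f hf => hin f (mem_coe.1 hf))
      (fun f hf hmem => ?_)
    obtain ⟨-, hfz⟩ := G.mem_verts_gframe_iff.1 hf
    refine IH z hz f (hin f hf) ⟨hmem, fun h => (hχ z hz).2 (hU z Set.sdiff_subset h)⟩ fun q hq hpq hn _ h => hn ?_
    have hfq : ¬ Affects (U q) f := fun ha => G.not_mem_esupp_gframe_of_pure hq hpq (hzN z hz) (mem_esupp.2 ha) hfz
    exact (diff_singleton_mem_iff_of_not_affects (hU q) hfq (hin f hf)).2 h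
  -- (ii) every pure member has no vertex
  have hVq : ∀ q ∈ W, gann U W q = ∅ → verts (U q) = ∅ := by
    intro q hq hpq
    -- removing a vertex `f ∈ χ z` of `U q` from `χ z`: only the status of `q` can change
    have hmove : ∀ z ∈ Z, ∀ f ∈ verts (U q), f ∈ χ z →
        (χ z ∈ U q ∧ χ z \ {f} ∉ U q ∧ ∀ z' ∈ Z, z' ≠ z → χ z' ∉ U q) := by
      intro z hz f hf hfχ
      have hfq : f ∈ esupp (U q) := (mem_verts.1 hf).1
      have hrem : χ z \ {f} ∈ gann U W z :=
        ⟨diff_singleton_mem_of_not_affects (isUpperSet_gframe U W hU z)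
          (fun ha => G.not_mem_esupp_gframe_of_pure hq hpq (hzN z hz) hfq (mem_esupp.2 ha)) (hχ z hz).1,
          fun h => (hχ z hz).2 (hU z Set.sdiff_subset h)⟩
      have hother : ∀ q' ∈ W, gann U W q' = ∅ → q' ≠ q → (χ z \ {f} ∈ U q' ↔ χ z ∈ U q') := by
        intro q' hq' hpq' hne'
        exact diff_singleton_mem_iff_of_not_affects (hU q')
          (fun ha => G.not_mem_esupp_of_pure_ne hq hpq hq' hpq' (Ne.symm hne') hfq (mem_esupp.2 ha)) hfχ
      by_contra hno
      refine IH z hz f hfχ hrem fun q' hq' hpq' hn hothers hχq' => ?_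
      by_cases hqq' : q' = q
      · subst hqq'; exact hno ⟨hχq', hn, hothers⟩
      · exact hn ((hother q' hq' hpq' hqq').2 hχq')
    have hverts_cf : ∀ f ∈ verts (U q), CoreFree U f := fun f hf =>
      ((G.mem_verts_gframe_iff (w := q)).1 (by rw [G.gframe_eq_of_pure hpq]; exact hf)).1
    by_cases hex : ∃ z₀ ∈ Z, χ z₀ ∈ U q
    · obtain ⟨z₀, hz₀, hq₀⟩ := hex
      -- every vertex lies in `χ z₀` and is pivotal there
      have hin : ∀ f ∈ verts (U q), f ∈ χ z₀ ∧ χ z₀ \ {f} ∉ U q := by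
        intro f hf
        obtain ⟨z, hz, hfz⟩ := KEY f (hverts_cf f hf)
        obtain ⟨_, hpiv, hothers⟩ := hmove z hz f hf hfz
        have hzz : z = z₀ := by
          by_contra hne; exact hothers z₀ hz₀ (Ne.symm hne) hq₀
        subst hzz
        exact ⟨hfz, hpiv⟩
      exact verts_eq_empty_of_pivotal (hU q) hq₀ (fun f hf => (hin f (mem_coe.1 hf)).1) fun f hf => (hin f hf).2
    · push Not at hex
      refine eq_empty_of_forall_notMem fun f hf => ?_
      obtain ⟨z, hz, hfz⟩ := KEY f (hverts_cf f hf)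
      exact hex z hz (hmove z hz f hf hfz).1
  -- (iii) no room for a core-free coordinate
  obtain ⟨f₀, hf₀⟩ := hE0
  obtain ⟨z, hz, hfz⟩ := KEY f₀ hf₀
  rcases hT z hz hfz with h | h
  · have := mem_verts_gframe_of_coreFree U W hU hf₀ (mem_coe.1 h)
    rw [hVz z hz] at this; exact notMem_empty _ this
  · rw [Set.mem_iUnion₂] at h
    obtain ⟨q, hq, hfq⟩ := h
    rw [mem_filter] at hq
    have : f₀ ∈ verts (U q) := mem_verts.2 ⟨mem_coe.1 hfq, hf₀ q⟩
    rw [hVq q hq.1 hq.2] at this; exact notMem_empty _ this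

/-- **THE MULTI-CROSS LEMMA (glued frame field, every order).**  For a non-empty set `Z` of members and annihilator points `χ z ∈ gann z`, at
least two pure members fail at every `χ z` — provided some coordinate is core-free. [this work] -/
theorem two_le_card_multiCross (hE0 : ∃ f, CoreFree U f) {Z : Finset κ} (hZ : Z.Nonempty) :
    ∀ (n : ℕ) (χ : κ → Set ι), (∑ z ∈ Z, (χ z).ncard) ≤ n → (∀ z ∈ Z, χ z ∈ gann U W z) →
      2 ≤ ((W.filter fun p => gann U W p = ∅).filter fun p => ∀ z ∈ Z, χ z ∉ U p).card := by
  intro n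
  induction n with
  | zero =>
    intro χ hn hχ
    by_contra hlt
    push Not at hlt
    refine G.multiCross_step hE0 hZ hχ (by omega) fun z hz g hg _ _ => ?_
    have h0 : (χ z).ncard = 0 := by
      have := Finset.single_le_sum (f := fun z => (χ z).ncard) (fun _ _ => Nat.zero_le _) hz; omega
    rw [Set.ncard_eq_zero (Set.toFinite _)] at h0
    rw [h0] at hg; exact hg
  | succ n ih =>
    intro χ hn hχ
    by_contra hlt
    push Not at hlt
    refine G.multiCross_step hE0 hZ hχ (by omega) fun z hz g hg hrem hP => ?_
    -- the tuple with `g` removed from `χ z` is smaller and still violating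
    set χ' : κ → Set ι := Function.update χ z (χ z \ {g}) with hχ'def
    have hχ'z : χ' z = χ z \ {g} := by simp [hχ'def]
    have hχ'o : ∀ z', z' ≠ z → χ' z' = χ z' := fun z' hne => by simp [hχ'def, hne]
    have hsum : (∑ z' ∈ Z, (χ' z').ncard) ≤ n := by
      have e1 : (∑ z' ∈ Z, (χ' z').ncard) = (χ' z).ncard + ∑ z' ∈ Z.erase z, (χ' z').ncard :=
        (add_sum_erase Z (fun z' => (χ' z').ncard) hz).symm
      have e2 : (∑ z' ∈ Z, (χ z').ncard) = (χ z).ncard + ∑ z' ∈ Z.erase z, (χ z').ncard :=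
        (add_sum_erase Z (fun z' => (χ z').ncard) hz).symm
      have e3 : (∑ z' ∈ Z.erase z, (χ' z').ncard) = ∑ z' ∈ Z.erase z, (χ z').ncard :=
        sum_congr rfl fun z' hz' => by rw [hχ'o z' (ne_of_mem_erase hz')]
      have e4 := Set.ncard_sdiff_singleton_add_one hg (Set.toFinite (χ z))
      rw [hχ'z] at e1
      omega
    have hχ' : ∀ z' ∈ Z, χ' z' ∈ gann U W z' := by
      intro z' hz'
      by_cases hzz : z' = z
      · subst hzz; rw [hχ'z]; exact hrem
      · rw [hχ'o z' hzz]; exact hχ z' hz'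
    have h2 := ih χ' hsum hχ'
    have hsub : ((W.filter fun p => gann U W p = ∅).filter fun p => ∀ z' ∈ Z, χ' z' ∉ U p) ⊆
        ((W.filter fun p => gann U W p = ∅).filter fun p => ∀ z' ∈ Z, χ z' ∉ U p) := by
      intro q hq
      simp only [mem_filter] at hq ⊢
      refine ⟨hq.1, ?_⟩
      have hothers : ∀ z' ∈ Z, z' ≠ z → χ z' ∉ U q := fun z' hz' hne => by
        have := hq.2 z' hz'; rwa [hχ'o z' hne] at this
      have hzq : χ z \ {g} ∉ U q := by have := hq.2 z hz; rwa [hχ'z] at this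
      intro z' hz'
      by_cases hzz : z' = z
      · subst hzz; exact hP q hq.1.1 hq.1.2 hzq hothers
      · exact hothers z' hz' hzz
    have := h2.trans (card_le_card hsub)
    omega

/-- **Multi-cross, packaged.** [this work] -/
theorem two_le_card_multiCross' (hE0 : ∃ f, CoreFree U f) {Z : Finset κ} (hZ : Z.Nonempty) {χ : κ → Set ι}
    (hχ : ∀ z ∈ Z, χ z ∈ gann U W z) :
    2 ≤ ((W.filter fun p => gann U W p = ∅).filter fun p => ∀ z ∈ Z, χ z ∉ U p).card :=
  G.two_le_card_multiCross hE0 hZ _ χ le_rfl hχ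

end GluedSetting

end GluedFrames

end Summit.CriticalPhenomena.PercolationContinuityZ3.Theorems
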